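import Mathlib
import HarnessLib
import Summits.NavierStokesRegularity.NavierStokesRegularity.Theorems.UnthreadedDoorCellFluxDefs
import Summits.NavierStokesRegularity.NavierStokesRegularity.Theorems.UnthreadedDoorNetFluxSphereMinusFinite

/-!
# Route `UnthreadedDoor`, crux `PoloidalLiouville` (stmt-NavierStokesRegularity-1222), WALL W1 — crux idea «indicatrix-bound», Λ-geo family:
# the COUNTING step «cells ≤ components of the regular part» (shared by Λ-geo, Λ-geo′(a)/(b), Λ-geo‴)

★ `cellSet_finite_ncard_le : 0 < r → (components of S_r(x₀) ∖ sphCrit f x₀ r).Finite → (cellSet f x₀ r).Finite ∧ (cellSet f x₀ r).ncard ≤ #components` —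
step (ii) of the custodian's Λ-geo recipe (`Cruxes/PoloidalLiouville/IndicatrixSketch.lean` v1.7.3, docstring of `stub_analyticCellFiniteness`), for an
ARBITRARY `f : E3 → ℝ` (no regularity): every connected component `C` of the regular part `X := S_r ∖ sphCrit` lies in one cell and the map `C ↦` (that
cell) is onto `cellSet`: a cell `cellOf x` with `x ∉ sphCrit` is the cell of the component of `x`; if `x` is an ISOLATED sphere-critical point, a small
connected cap through `x` — here the radial projection `q ↦ x₀ + (r/‖q − x₀‖) • (q − x₀)` of a small ball about `x`, which stays within twice the
radius of the ball — misses `sphCrit ∖ {x} ⊇ sheetTrace`, so it lies in `cellOf x` and contains a regular point `y ≠ x` (a round `2`-sphere has no isolated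
points: `NetFlux.nonempty_sphere_inter_diff_finite`, p-landed «null-time» toolkit), whence `cellOf x = cellOf y`.  Supporting: `exists_isPreconnected_cap_subset`
(inside every neighbourhood of a sphere point there is a preconnected subset of the sphere through the point containing the trace of a smaller ball).
Pure topology; nothing here is an NS statement; ⟨1222⟩ / W1 / NS regularity OPEN.  `--supports stmt-NavierStokesRegularity-1222 --as helper`.  [folklore]
-/

noncomputable section

-- the summit and its single sub-problem share the name (CONVENTIONS §1)
set_option linter.dupNamespace false

open Set Function Filter Topology Metric
open scoped Topology

namespace Summit.NavierStokesRegularity.NavierStokesRegularity.Theorems.PoloidalLiouville.Indicatrix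

open Summit.NavierStokesRegularity.NavierStokesRegularity.Theorems.PoloidalLiouville.NetFlux (E3 nonempty_sphere_inter_diff_finite)
open Summit.NavierStokesRegularity.NavierStokesRegularity.Theorems.PoloidalLiouville.CellFlux (sphCrit sheetTrace cellOf cellSet)
open Literature.Analysis Literature.Analysis.FluidPDE

/-- **Small connected caps.**  For `x ∈ S_r(x₀)` (`0 < r`) and a neighbourhood `U` of `x`, there are `ε > 0` and a preconnected `K ⊆ S_r(x₀) ∩ U` with
`S_r(x₀) ∩ B(x, ε) ⊆ K` (the radial projection onto the sphere of the ball `B(x, ε)`, `2ε` below the size of `U` and `ε ≤ r/2`). [folklore] -/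
theorem exists_isPreconnected_cap_subset {x₀ x : E3} {r : ℝ} (hr : 0 < r) (hx : x ∈ sphere x₀ r) {U : Set E3} (hU : U ∈ 𝓝 x) :
    ∃ ε > (0 : ℝ), ∃ K : Set E3, K ⊆ sphere x₀ r ∩ U ∧ IsPreconnected K ∧ sphere x₀ r ∩ ball x ε ⊆ K := by
  obtain ⟨ε₀, hε₀, hball⟩ := Metric.mem_nhds_iff.1 hU
  set ε : ℝ := min (ε₀ / 2) (r / 2) with hε
  have hεpos : 0 < ε := lt_min (half_pos hε₀) (half_pos hr)
  have hεε₀ : 2 * ε ≤ ε₀ := by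
    have : ε ≤ ε₀ / 2 := min_le_left _ _
    linarith
  have hεr : ε ≤ r / 2 := min_le_right _ _
  have hxr : ‖x - x₀‖ = r := by rw [← dist_eq_norm]; exact mem_sphere.1 hx
  -- the radial projection
  set π : E3 → E3 := fun q => x₀ + (r * ‖q - x₀‖⁻¹) • (q - x₀) with hπ
  -- on the ball `B(x, ε)` the projection is well defined and continuous
  have hfar : ∀ q ∈ ball x ε, r / 2 ≤ ‖q - x₀‖ := by
    intro q hq
    have h1 : ‖x - q‖ < ε := by rw [← dist_eq_norm, dist_comm]; exact mem_ball.1 hq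
    have h2 : ‖x - x₀‖ ≤ ‖x - q‖ + ‖q - x₀‖ := norm_sub_le_norm_sub_add_norm_sub _ _ _
    linarith
  have hne : ∀ q ∈ ball x ε, ‖q - x₀‖ ≠ 0 := fun q hq => by
    have := hfar q hq
    exact (lt_of_lt_of_le (half_pos hr) this).ne'
  have hcont : ContinuousOn π (ball x ε) := by
    have h1 : ContinuousOn (fun q : E3 => ‖q - x₀‖) (ball x ε) := by fun_prop
    have h2 : ContinuousOn (fun q : E3 => r * ‖q - x₀‖⁻¹) (ball x ε) :=
      continuousOn_const.mul (h1.inv₀ hne)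
    exact continuousOn_const.add (h2.smul (continuousOn_id.sub continuousOn_const))
  refine ⟨ε, hεpos, π '' ball x ε, ?_, (convex_ball x ε).isPreconnected.image π hcont, ?_⟩
  · -- `π(B(x,ε)) ⊆ S_r ∩ U`
    rintro _ ⟨q, hq, rfl⟩
    have hq0 : ‖q - x₀‖ ≠ 0 := hne q hq
    have hqpos : 0 < ‖q - x₀‖ := (norm_nonneg _).lt_of_ne' hq0
    refine ⟨?_, hball ?_⟩
    · rw [mem_sphere, dist_eq_norm, hπ]
      simp only [add_sub_cancel_left, norm_smul, norm_mul, Real.norm_eq_abs, abs_of_pos hr, abs_inv, abs_of_pos hqpos]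
      field_simp
    · rw [mem_ball, dist_eq_norm]
      -- `‖π q − x‖ ≤ ‖π q − q‖ + ‖q − x‖ < 2ε ≤ ε₀`
      have hπq : π q - q = (r * ‖q - x₀‖⁻¹ - 1) • (q - x₀) := by
        rw [hπ]; simp only [sub_smul, one_smul]; abel
      have h1 : ‖π q - q‖ ≤ ‖x - q‖ := by
        rw [hπq, norm_smul, Real.norm_eq_abs]
        have h3 : |r * ‖q - x₀‖⁻¹ - 1| * ‖q - x₀‖ = |r - ‖q - x₀‖| := by
          rw [← abs_of_pos hqpos, ← abs_mul, abs_of_pos hqpos]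
          congr 1
          field_simp
        rw [h3, ← hxr]
        have h4 := abs_norm_sub_norm_le (x - x₀) (q - x₀)
        rwa [sub_sub_sub_cancel_right] at h4
      have h2 : ‖q - x‖ < ε := by rw [← dist_eq_norm]; exact mem_ball.1 hq
      calc ‖π q - x‖ ≤ ‖π q - q‖ + ‖q - x‖ := norm_sub_le_norm_sub_add_norm_sub _ _ _
        _ < ε + ε := by
            have : ‖x - q‖ < ε := by rw [norm_sub_rev]; exact h2
            linarith
        _ ≤ ε₀ := by linarith
  · -- the trace of the ball on the sphere is fixed by `π`
    rintro q ⟨hqS, hqB⟩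
    refine ⟨q, hqB, ?_⟩
    have hq : ‖q - x₀‖ = r := by rw [← dist_eq_norm]; exact mem_sphere.1 hqS
    rw [hπ]
    simp only [hq, mul_inv_cancel₀ hr.ne', one_smul, add_sub_cancel]

/-- ★ **The counting step: cells are at most as many as the components of the regular part.**  For ANY `f : E3 → ℝ` and `0 < r`: if the set of
connected components of `S_r(x₀) ∖ sphCrit f x₀ r` is finite, then `cellSet f x₀ r` is finite and `(cellSet f x₀ r).ncard ≤` the number of those
components. [folklore] -/
theorem cellSet_finite_ncard_le {f : E3 → ℝ} {x₀ : E3} {r : ℝ} (hr : 0 < r)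
    (hfin : (connectedComponentIn (sphere x₀ r \ sphCrit f x₀ r) '' (sphere x₀ r \ sphCrit f x₀ r)).Finite) :
    (cellSet f x₀ r).Finite ∧
      (cellSet f x₀ r).ncard ≤ (connectedComponentIn (sphere x₀ r \ sphCrit f x₀ r) '' (sphere x₀ r \ sphCrit f x₀ r)).ncard := by
  set S : Set E3 := sphere x₀ r with hS
  set Z : Set E3 := sphCrit f x₀ r with hZ
  set Γ : Set E3 := sheetTrace f x₀ r with hΓ
  set X : Set E3 := S \ Z with hX
  set Y : Set E3 := S \ Γ with hY
  have hΓZ : Γ ⊆ Z := fun z hz => hz.1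
  have hXY : X ⊆ Y := sdiff_subset_sdiff_right hΓZ
  -- (1) every cell is the cell of a REGULAR point
  have key : ∀ x ∈ Y, ∃ y ∈ X, cellOf f x₀ r x = cellOf f x₀ r y := by
    intro x hx
    by_cases hxZ : x ∈ Z
    · -- `x` is an isolated sphere-critical point
      have hnacc : ¬ AccPt x (𝓟 Z) := fun h => hx.2 ⟨hxZ, h⟩
      rw [accPt_iff_nhds] at hnacc
      push Not at hnacc
      obtain ⟨U, hU, hUZ⟩ := hnacc
      obtain ⟨ε, hε, K, hKSU, hKconn, hKball⟩ := exists_isPreconnected_cap_subset hr hx.1 hU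
      -- the cap misses the sheet traces, hence lies in the cell of `x`
      have hKY : K ⊆ Y := by
        intro z hz
        refine ⟨(hKSU hz).1, fun hzΓ => ?_⟩
        have hzx : z = x := hUZ z ⟨(hKSU hz).2, hΓZ hzΓ⟩
        rw [hzx] at hzΓ
        exact hx.2 hzΓ
      have hxK : x ∈ K := hKball ⟨hx.1, mem_ball_self hε⟩
      have hKcell : K ⊆ cellOf f x₀ r x := hKconn.subset_connectedComponentIn hxK hKY
      -- a regular point of the cap
      obtain ⟨y, ⟨⟨hyS, hyB⟩, hyx⟩⟩ := nonempty_sphere_inter_diff_finite hr hx.1 isOpen_ball (mem_ball_self hε) (finite_singleton x)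
      have hyK : y ∈ K := hKball ⟨hyS, hyB⟩
      have hyZ : y ∉ Z := fun hyZ => hyx (hUZ y ⟨(hKSU hyK).2, hyZ⟩)
      exact ⟨y, ⟨hyS, hyZ⟩, connectedComponentIn_eq (hKcell hyK)⟩
    · exact ⟨x, ⟨hx.1, hxZ⟩, rfl⟩
  -- (2) the map «component ↦ union of the cells of its points» and its value on components
  let g : Set E3 → Set E3 := fun C => ⋃ y ∈ C, cellOf f x₀ r y
  have hg : ∀ y ∈ X, g (connectedComponentIn X y) = cellOf f x₀ r y := by
    intro y hy
    have hsame : ∀ y' ∈ connectedComponentIn X y, cellOf f x₀ r y' = cellOf f x₀ r y := by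
      intro y' hy'
      have hC : connectedComponentIn X y ⊆ cellOf f x₀ r y :=
        isPreconnected_connectedComponentIn.subset_connectedComponentIn (mem_connectedComponentIn hy)
          ((connectedComponentIn_subset _ _).trans hXY)
      exact (connectedComponentIn_eq (hC hy')).symm
    apply subset_antisymm
    · exact iUnion₂_subset fun y' hy' => (hsame y' hy').subset
    · exact subset_iUnion₂_of_subset y (mem_connectedComponentIn hy) Subset.rfl
  -- (3) `cellSet ⊆ g '' components`
  have hsub : cellSet f x₀ r ⊆ g '' (connectedComponentIn X '' X) := by
    rintro _ ⟨x, hx, rfl⟩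
    obtain ⟨y, hy, hxy⟩ := key x hx
    exact ⟨connectedComponentIn X y, ⟨y, hy, rfl⟩, by rw [hg y hy, hxy]⟩
  exact ⟨(hfin.image g).subset hsub, (ncard_le_ncard hsub (hfin.image g)).trans (ncard_image_le hfin)⟩

end Summit.NavierStokesRegularity.NavierStokesRegularity.Theorems.PoloidalLiouville.Indicatrix

end
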